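import Literature.NumberTheory.EllipticCurves.TwoAdicImageSurjectivityModFourProofs
import HarnessLib

/-!
# Dokchitser–Dokchitser's Lemma in print generality: `Gal(K(E[4])/K) ≤ ℍ` up to conjugacy iff `j = -4t³(t + 8)` (proofs only)

Sorry-free `Proofs` companion (bookkeeping definitions and theorems; no named fact, no instance;
D-0014/D-0026). T. Dokchitser, V. Dokchitser, *Surjectivity of mod `2ⁿ` representations of
elliptic curves*, Math. Z. 272 (2012) 961–964, **Lemma (p. 962)**: "Let `E/ℚ` be the elliptic curve
`y² = x³ + ax + b` with `b ≠ 0`. The following conditions are equivalent: (1) `Gal(ℚ(E[4])/ℚ)` is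
conjugate to a subgroup of `ℍ`. (2) The polynomial
`f(x) = x⁴ - 4ax³ + 6a²x² + 4(7a³ + 54b²)x + (17a⁴ + 108ab²)` has a rational root.
(3) `j(E) = -4t³(t + 8)` for some `t ∈ ℚ`."

The file `TwoAdicImageSurjectivityModFourProofs` proves (1) ⟺ (3) under the hypotheses of the
Theorem's clause (2) (`ρ̄_{E,2}` onto, `-Δ ∉ K^{×2}`), which is all that clause needs. Here the
Lemma is proved AS PRINTED — the only hypothesis is `b ≠ 0`, i.e. `c₆ ≠ 0` (`c₆ = -864b`), for any
model over any perfect field `K` with `char K ≠ 2` — following the printed proof: "`h ↦ θ_{hC}`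
defines a transitive action of `GL₂(ℤ/4ℤ)` on [the four classes], and for `h ∈ Gal(ℚ(E[4])/ℚ)` it
coincides with the Galois action … Because all four `θ_C` are distinct, the stabiliser of `θ_ℍ` is
precisely `ℍ`, and the stabilisers of the others are the conjugates of `ℍ`. So `Gal(ℚ(E[4])/ℚ)` is
conjugate to a subgroup of `ℍ` if and only if one of the `θ_C` is rational."

* §0 (kernel-decidable) the action of a MATRIX `N ∈ GL₂(ℤ/4ℤ)` (as its tuple of entries) on the
  four sign classes `η ∈ (ℤ/2)²` of `FourTorsionResolventCocycleProofs`: `π_N`, `s_N` read off the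
  columns `N w_i`, `actQ N`; the table "the stabiliser of the class `η` is `k_η⁻¹ ℍ k_η`" for four
  explicit `k_η` (`conj_kstab_mem_HH_of_actQ_eq`), "`ℍ` fixes its class", and "an element which is
  an involution modulo the kernel `{±1, ±(1 + 2w₀)}` fixes a class";
* §1 the bridge `actE π_σ s_σ = actQ (ρ̄₄(σ))` ("for `h ∈ Gal` it coincides with the Galois action");
* §2 the four classes are distinct as soon as `c₆ ≠ 0` ("the discriminant of `f` is `3⁶b²Δ³`"):
  `u_i = u_j` forces `e_i + e_j = 2e_k`, and `c₆ = -32 ∏ (e_i + e_j - 2e_k)`;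
* §3 (1) ⟹ (3) and §4 (3) ⟹ (1) over a perfect field, `char K ≠ 2`, `c₆ ≠ 0`;
* §5 over `ℚ`: (1) ⟺ (3) for any model with `c₆ ≠ 0`, and the VERBATIM three-way equivalence for
  `y² = x³ + ax + b`, `b ≠ 0`, with the printed quartic `f` (`64·f(r) = 64(a - r)⁴ + 32Δ(a - r) + c₄Δ`).

## References

* [DokchitserDokchitserMathZ2012] T. Dokchitser, V. Dokchitser, Math. Z. 272 (2012) 961–964,
  Lemma (p. 962) and its proof. [corpus:paper:arxiv-1104.5031 p0001 L109–L171, p0002 L1–L12]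
* [SilvermanAEC2009] J. H. Silverman, *The Arithmetic of Elliptic Curves*, 2nd ed., GTM 106
  (2009), III.1 (b- and c-invariants), III.7, VIII.1.
-/

set_option autoImplicit false

/-! ### §0. The action of `GL₂(ℤ/4ℤ)` on the four classes, by matrices (kernel-decidable) -/

namespace Literature.NumberTheory.EllipticCurves.DokchitserDokchitser2012.LevelFour

open Literature.NumberTheory.GaloisRepresentations.GL2Mod8 (P4 P4.det)
open Literature.NumberTheory.GaloisRepresentations.GL2Mod4

/-- The three columns `N w₀, N w₁, N w₂ = N w₀ + N w₁` of a tuple `N = (N₀₀, N₀₁, N₁₀, N₁₁)`, as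
pairs (bookkeeping). [folklore] -/
def colQ (p : Q4) (i : Fin 3) : ZMod 4 × ZMod 4 :=
  ![(p.1, p.2.2.1), (p.2.1, p.2.2.2), (p.1 + p.2.1, p.2.2.1 + p.2.2.2)] i

/-- The vectors `w₀, w₁, w₂ = w₀ + w₁` of `(ℤ/4)²`, as pairs (bookkeeping). [folklore] -/
def wcol (j : Fin 3) : ZMod 4 × ZMod 4 := ![(1, 0), (0, 1), (1, 1)] j

/-- `π_N i`: the index `j` with `N w_i ≡ w_j (mod 2)` (junk value `2` when `N w_i ≡ 0`)
(bookkeeping). [folklore] -/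
def piQ (p : Q4) (i : Fin 3) : Fin 3 :=
  if 2 * (colQ p i).1 = 2 ∧ 2 * (colQ p i).2 = 0 then 0
  else if 2 * (colQ p i).1 = 0 ∧ 2 * (colQ p i).2 = 2 then 1 else 2

/-- `π_N⁻¹ j`, by search (bookkeeping). [folklore] -/
def piQinv (p : Q4) (j : Fin 3) : Fin 3 :=
  if piQ p 0 = j then 0 else if piQ p 1 = j then 1 else 2

/-- `s_N(i) ∈ ℤ/2`: `0` iff `N w_i = ± w_{π_N i}` (bookkeeping). [folklore] -/
def sQ (p : Q4) (i : Fin 3) : ZMod 2 :=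
  if colQ p i = wcol (piQ p i) ∨ colQ p i = -wcol (piQ p i) then 0 else 1

/-- **The action of a matrix `N` on the four sign classes** `η ∈ (ℤ/2)²`: `actE π_N s_N` with the
inverse permutation computed by search ("`h ↦ θ_{hC}` defines a transitive action of `GL₂(ℤ/4ℤ)`").
[cite: DokchitserDokchitserMathZ2012, Lemma (p. 962), proof (the action h ↦ θ_{hC})] -/
def actQ (p : Q4) (η : ZMod 2 × ZMod 2) : ZMod 2 × ZMod 2 :=
  (etaf η (piQinv p 0) + sQ p (piQinv p 0) + (sQ p 0 + sQ p 1 + sQ p 2),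
    etaf η (piQinv p 1) + sQ p (piQinv p 1) + (sQ p 0 + sQ p 1 + sQ p 2))

/-- The conjugators `k_η` with `Stab(η) = k_η⁻¹ ℍ k_η`: `k_{(1,0)} = 1` (`ℍ` itself fixes the class
`(1, 0)`), `k_{(0,0)} = (1 0; 2 1)`, `k_{(0,1)} = diag(1, 3)`, `k_{(1,1)} = (1 0; 2 3)` (bookkeeping).
[folklore] -/
def kstab (η : ZMod 2 × ZMod 2) : Q4 :=
  if η = (0, 0) then (1, 0, 2, 1) else if η = (0, 1) then (1, 0, 0, 3)
  else if η = (1, 1) then (1, 0, 2, 3) else (1, 0, 0, 1)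

/-- Membership in `ℍ`, as the defining predicate of `GL2Mod4.HH` (bookkeeping abbreviation for
kernel evaluation; `hhPred_iff`). [cite: DokchitserDokchitserMathZ2012, proof of Theorem (2) (the subgroup ℍ)] -/
abbrev HHPred (h : Q4) : Prop :=
  Q4.det h * Q4.det h = 1 ∧
    ∃ ab : ZMod 4 × ZMod 4, Q4.mul (Q4.mul h w0) (Q4.inv h) = Q4.lin ab.1 ab.2 w0

/-- `HHPred h ↔ h ∈ ℍ`. [cite: DokchitserDokchitserMathZ2012, proof of Theorem (2) (the subgroup ℍ)] -/
theorem hhPred_iff (h : Q4) : HHPred h ↔ h ∈ HH := (mem_HH_iff h).symm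

set_option synthInstance.maxSize 4096 in
set_option maxRecDepth 100000 in
set_option maxHeartbeats 0 in
/-- For an invertible `N`, `π_N i = j` iff `N w_i ≡ w_j (mod 2)` (`π_N` is a genuine permutation).
[cite: SilvermanAEC2009, III.7 (the Galois action on E[2] ⊂ E[4])] -/
theorem piQ_eq_iff : ∀ p : Q4, Q4.det p * Q4.det p = 1 → ∀ i j : Fin 3,
    (piQ p i = j ↔ 2 * (colQ p i).1 = 2 * (wcol j).1 ∧ 2 * (colQ p i).2 = 2 * (wcol j).2) := by
  decide +kernel

set_option synthInstance.maxSize 4096 in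
set_option maxRecDepth 100000 in
set_option maxHeartbeats 0 in
/-- **The stabiliser of the class `η` is `k_η⁻¹ ℍ k_η`**: an invertible `N` fixing `η` has
`k_η N k_η⁻¹ ∈ ℍ` ("the stabiliser of `θ_ℍ` is precisely `ℍ`, and the stabilisers of the others are
the conjugates of `ℍ`"). [cite: DokchitserDokchitserMathZ2012, Lemma (p. 962), proof (the stabilisers of the θ_C)] -/
theorem conj_kstab_hhPred_of_actQ_eq : ∀ η : ZMod 2 × ZMod 2, ∀ p : Q4, Q4.det p * Q4.det p = 1 →
    actQ p η = η → HHPred (Q4.mul (Q4.mul (kstab η) p) (Q4.inv (kstab η))) := by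
  decide +kernel

set_option synthInstance.maxSize 4096 in
set_option maxRecDepth 100000 in
set_option maxHeartbeats 0 in
/-- `k_η` is invertible. [cite: DokchitserDokchitserMathZ2012, Lemma (p. 962), proof (the stabilisers of the θ_C are the conjugates of ℍ)] -/
theorem kstab_det : ∀ η : ZMod 2 × ZMod 2, Q4.det (kstab η) * Q4.det (kstab η) = 1 := by
  decide +kernel

set_option synthInstance.maxSize 4096 in
set_option maxRecDepth 100000 in
set_option maxHeartbeats 0 in
/-- **`ℍ` fixes its class**: every `h ∈ ℍ` fixes `(1, 0)` ("the stabiliser of `θ_ℍ` is precisely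
`ℍ`", the inclusion `ℍ ≤ Stab`). [cite: DokchitserDokchitserMathZ2012, Lemma (p. 962), proof (the stabiliser of θ_ℍ)] -/
theorem actQ_eq_of_hhPred : ∀ h : Q4, HHPred h → actQ h (1, 0) = (1, 0) := by
  decide +kernel

set_option synthInstance.maxSize 4096 in
set_option maxRecDepth 100000 in
set_option maxHeartbeats 0 in
/-- **An element which is an involution modulo the kernel fixes a class**: if `N ≢ 1 (mod 2)` and
`N² ∈ {±1, ±(1 + 2w₀)}` then `actQ N` has a fixed class (the transpositions of `S₄ ≅ GL₂(ℤ/4ℤ)/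
{±1, ±(1 + 2w₀)}` have fixed points; the `4`-cycles square into the kernel of reduction but outside
`{±1, ±(1 + 2w₀)}`). [cite: DokchitserDokchitserMathZ2012, Lemma (p. 962), proof (the stabilisers of the θ_C are the conjugates of ℍ)] -/
theorem actQ_exists_fixed : ∀ p : Q4, Q4.det p * Q4.det p = 1 → Q4.par p ≠ (1, 0, 0, 1) →
    (Q4.mul p p = (1, 0, 0, 1) ∨ Q4.mul p p = (3, 0, 0, 3) ∨ Q4.mul p p = (1, 2, 2, 3) ∨
      Q4.mul p p = (3, 2, 2, 1)) → ∃ η : ZMod 2 × ZMod 2, actQ p η = η := by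
  decide +kernel

set_option synthInstance.maxSize 4096 in
/-- In `S₃`: if `a ≠ 1`, `a`, `b` and `a⁻¹b` all have a fixed point, then `b ∈ {1, a}` (a subgroup
of `S₃ ≅ GL₂(𝔽₂)` without `3`-cycles has order `≤ 2`).
[cite: DokchitserDokchitserMathZ2012, proof of the Theorem (GL₂(𝔽₂) ≅ S₃)] -/
theorem perm_eq_one_or_eq : ∀ a b : Equiv.Perm (Fin 3), a ≠ 1 → (∃ k, a k = k) → (∃ k, b k = k) →
    (∃ k, (a⁻¹ * b) k = k) → b = 1 ∨ b = a := by
  decide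

set_option synthInstance.maxSize 4096 in
/-- In `S₃` an element with a fixed point is an involution. [cite: DokchitserDokchitserMathZ2012, proof of the Theorem (GL₂(𝔽₂) ≅ S₃)] -/
theorem perm_mul_self_of_exists_fixed : ∀ a : Equiv.Perm (Fin 3), (∃ k, a k = k) → a * a = 1 := by
  decide

set_option synthInstance.maxSize 4096 in
/-- The four tuples `klift a`, `a ∈ 𝔽₂[ω̄]`: `1, 3·1, 1 + 2w₀, 3 + 2w₀`. [folklore] -/
private theorem klift_F4set_cases' : ∀ a : P4, a ∈ F4set →
    klift a = (1, 0, 0, 1) ∨ klift a = (3, 0, 0, 3) ∨ klift a = (1, 2, 2, 3) ∨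
      klift a = (3, 2, 2, 1) := by
  decide

/-- An index of `Fin 3` other than `0, 1` is `2`. [folklore] -/
private theorem fin3_eq_two : ∀ x : Fin 3, x ≠ 0 → x ≠ 1 → x = 2 := by decide

end Literature.NumberTheory.EllipticCurves.DokchitserDokchitser2012.LevelFour

noncomputable section

open scoped Classical

open Matrix WeierstrassCurve

namespace Literature.NumberTheory.EllipticCurves.DokchitserDokchitser2012

open Literature.NumberTheory.GaloisRepresentations.GL2Mod8 (P4 P4.mul P4.det sgnUnit
  sgnUnit_zero sgnUnit_one sgnUnit_add)
open Literature.NumberTheory.GaloisRepresentations.GL2Mod4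

universe u

variable {K : Type u} [Field K] (W : WeierstrassCurve K) [W.IsElliptic] (h2 : (2 : K) ≠ 0)

namespace LevelFour

/-! ### §1. The bridge: `actE π_σ s_σ = actQ (ρ̄₄(σ))` -/

/-- **`π_σ i = j` iff `2·ρ̄₄(σ) w_i = 2·w_j`** (`σ L_i = L_{π_σ i}` and `L_j = e⁻¹(2 w_j)`).
[cite: SilvermanAEC2009, III.7 (the Galois action on E[2] ⊂ E[4])] -/
theorem pi_apply_eq_iff_two_nsmul (σ : Field.absoluteGaloisGroup K) (i j : Fin 3) :
    pi W h2 σ i = j ↔ 2 • (M W h2 σ *ᵥ wvec i) = 2 • wvec j := by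
  rw [← (letter_injective W h2).eq_iff, letter_pi, ← (T_injective W h2).eq_iff, T_permGal,
    ← Subtype.coe_inj, AddSubgroup.torsionBy.coe_smul, coe_T_letter, coe_T_letter,
    ← AddSubgroup.torsionBy.coe_smul, Subtype.coe_inj, ← (frame4 W h2).apply_eq_iff_eq,
    rhoMat_mulVec, AddEquiv.apply_symm_apply, AddEquiv.apply_symm_apply, Matrix.mulVec_smul]

omit [W.IsElliptic] in
/-- `2·N w_i = 2·w_j` on entries. [folklore] -/
private theorem two_nsmul_mulVec_wvec_eq_iff' (N : M4) (i j : Fin 3) :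
    2 • (N *ᵥ wvec i) = 2 • wvec j ↔
      2 * (colQ (tup N) i).1 = 2 * (wcol j).1 ∧ 2 * (colQ (tup N) i).2 = 2 * (wcol j).2 := by
  rw [funext_iff, Fin.forall_fin_two]
  fin_cases i <;> fin_cases j <;> simp [nsmul_eq_mul, colQ, wcol, tup, mul_add]

omit [W.IsElliptic] in
/-- `N w_i = ± w_j` on entries. [folklore] -/
private theorem mulVec_wvec_eq_iff' (N : M4) (i j : Fin 3) :
    (N *ᵥ wvec i = wvec j ↔ colQ (tup N) i = wcol j) ∧
      (N *ᵥ wvec i = -wvec j ↔ colQ (tup N) i = -wcol j) := by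
  constructor <;> rw [funext_iff, Fin.forall_fin_two] <;> fin_cases i <;> fin_cases j <;>
    simp [Matrix.mulVec, dotProduct, Fin.sum_univ_two, colQ, wcol, tup]

/-- **`π_σ = π_{ρ̄₄(σ)}`**: the index permutation is read off the matrix.
[cite: SilvermanAEC2009, III.7 (the Galois action on E[2] ⊂ E[4])] -/
theorem pi_eq_piQ (σ : Field.absoluteGaloisGroup K) (i : Fin 3) :
    pi W h2 σ i = piQ (tup (M W h2 σ)) i :=
  ((piQ_eq_iff _ (det_sq (rhoMat W (frame4 W h2)) σ).2 i _).mpr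
    ((two_nsmul_mulVec_wvec_eq_iff' _ i _).mp ((pi_apply_eq_iff_two_nsmul W h2 σ i _).mp rfl))).symm

/-- `π_σ⁻¹ = π_{ρ̄₄(σ)}⁻¹` (computed by search). [cite: SilvermanAEC2009, III.7 (the Galois action on E[2] ⊂ E[4])] -/
theorem pi_symm_eq_piQinv (σ : Field.absoluteGaloisGroup K) (j : Fin 3) :
    (pi W h2 σ).symm j = piQinv (tup (M W h2 σ)) j := by
  unfold piQinv
  split_ifs with h0 h1
  · exact (Equiv.symm_apply_eq _).mpr (by rw [pi_eq_piQ, h0])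
  · exact (Equiv.symm_apply_eq _).mpr (by rw [pi_eq_piQ, h1])
  · refine fin3_eq_two _ (fun h ↦ h0 ?_) (fun h ↦ h1 ?_)
    · rw [← pi_eq_piQ, ← h, Equiv.apply_symm_apply]
    · rw [← pi_eq_piQ, ← h, Equiv.apply_symm_apply]

/-- **`s_σ = s_{ρ̄₄(σ)}`**: the signs are read off the matrix. [cite: DokchitserDokchitserMathZ2012, Lemma (p. 962), proof (h(θ_C) = θ_{hC})] -/
theorem sgnH_eq_sQ (σ : Field.absoluteGaloisGroup K) (i : Fin 3) :
    sgnH W h2 σ i = sQ (tup (M W h2 σ)) i := by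
  obtain ⟨hp, hm⟩ := mulVec_wvec_eq_iff' (M W h2 σ) i (piQ (tup (M W h2 σ)) i)
  unfold sgnH sQ
  rw [pi_eq_piQ]
  by_cases hc : colQ (tup (M W h2 σ)) i = wcol (piQ (tup (M W h2 σ)) i) ∨
      colQ (tup (M W h2 σ)) i = -wcol (piQ (tup (M W h2 σ)) i)
  · rw [if_pos hc, if_pos (by rwa [hp, hm])]
  · rw [if_neg hc, if_neg (by rwa [hp, hm])]

/-- **"For `h ∈ Gal(K(E[4])/K)` it coincides with the Galois action"**: the pair `(π_σ, s_σ)` acts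
on the classes as the matrix `ρ̄₄(σ)` does, `actE π_σ s_σ = actQ (ρ̄₄(σ))`; with `smul_w`,
`σ w_η = w_{actQ (ρ̄₄ σ) η}`. [cite: DokchitserDokchitserMathZ2012, Lemma (p. 962), proof (h(θ_C) = θ_{hC} coincides with the Galois action)] -/
theorem actE_eq_actQ (σ : Field.absoluteGaloisGroup K) (η : ZMod 2 × ZMod 2) :
    actE (pi W h2 σ) (sgnH W h2 σ) η = actQ (tup (M W h2 σ)) η := by
  have hs : sgnH W h2 σ = sQ (tup (M W h2 σ)) := funext (sgnH_eq_sQ W h2 σ)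
  simp only [actE, actQ, pi_symm_eq_piQinv, hs]

/-- `σ w_η = w_{actQ (ρ̄₄ σ) η}`. [cite: DokchitserDokchitserMathZ2012, Lemma (p. 962), proof (h(θ_C) = θ_{hC})] -/
theorem smul_w_eq_actQ (σ : Field.absoluteGaloisGroup K) (η : ZMod 2 × ZMod 2) :
    σ • w W h2 η = w W h2 (actQ (tup (M W h2 σ)) η) := by
  rw [smul_w, actE_eq_actQ]

/-- **The `≡ 1 (mod 2)` part of an image conjugate into `ℍ` lies in `{±1, ±(1 + 2w₀)}`** (the
latter is `ℍ ∩ ker`, stable under conjugation).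
[cite: DokchitserDokchitserMathZ2012, proof of Theorem (2) (the subgroup ℍ; its elements ≡ 1 mod 2)] -/
theorem tup_mem_four_of_conj_subset_HH {k : M4} (hkdet : k.det * k.det = 1)
    (hkH : ∀ σ : Field.absoluteGaloisGroup K, tup (k * M W h2 σ * inv' k) ∈ HH)
    (ν : Field.absoluteGaloisGroup K) (hν : pi W h2 ν = 1) :
    tup (M W h2 ν) = (1, 0, 0, 1) ∨ tup (M W h2 ν) = (3, 0, 0, 3) ∨
      tup (M W h2 ν) = (1, 2, 2, 3) ∨ tup (M W h2 ν) = (3, 2, 2, 1) := by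
  have hkdet' : Q4.det (tup k) * Q4.det (tup k) = 1 := by rw [← det_eq]; exact hkdet
  have hpar : Q4.par (tup (M W h2 ν)) = (1, 0, 0, 1) := (pi_eq_one_iff W h2 ν).mp hν
  set a := Q4.half (tup (M W h2 ν)) with ha
  have hkl : tup (M W h2 ν) = klift a := eq_klift_half _ hpar
  have hH := hkH ν
  rw [tup_mul, tup_mul, tup_inv', hkl, conj_klift _ hkdet'] at hH
  have haF : a ∈ F4set := mem_F4set_of_conj_mem _
    ((Q4.det_mul_self_iff _).mp hkdet') a (klift_mem_HH_imp _ hH)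
  have h4 := klift_F4set_cases' a haF
  rwa [← hkl] at h4

/-! ### §2. The four classes are distinct as soon as `c₆ ≠ 0` -/

include h2 in
/-- `2 ≠ 0`, `4 ≠ 0` in `K̄`. [folklore] -/
private theorem two_four_ne_zero'' :
    (2 : AlgebraicClosure K) ≠ 0 ∧ (4 : AlgebraicClosure K) ≠ 0 := by
  have h2' : (2 : AlgebraicClosure K) ≠ 0 := fun h0 ↦
    h2 ((algebraMap K (AlgebraicClosure K)).injective (by rw [map_ofNat, h0, map_zero]))
  exact ⟨h2', by rw [show (4 : AlgebraicClosure K) = 2 * 2 by norm_num]; exact mul_ne_zero h2' h2'⟩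

/-- **`c₆ = -32 (e₀ + e₁ - 2e₂)(e₀ + e₂ - 2e₁)(e₁ + e₂ - 2e₀)`** over `K̄` (`c₆ = -b₂³ + 36b₂b₄ - 216b₆`
and Vieta for the `2`-division cubic `4x³ + b₂x² + 2b₄x + b₆ = 4∏(x - e_i)`).
[cite: SilvermanAEC2009, III.1 (c₆ = -b₂³ + 36 b₂ b₄ - 216 b₆; the 2-division cubic)] -/
theorem algebraMap_c₆_eq :
    algebraMap K (AlgebraicClosure K) W.c₆ =
      -32 * ((xT W h2 0 + xT W h2 1 - 2 * xT W h2 2) * (xT W h2 0 + xT W h2 2 - 2 * xT W h2 1) *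
        (xT W h2 1 + xT W h2 2 - 2 * xT W h2 0)) := by
  obtain ⟨hb, hc, hd⟩ := vieta_twoTorsion W h2
  have : algebraMap K (AlgebraicClosure K) W.c₆ = (W.baseChange (AlgebraicClosure K)).c₆ := by
    simp only [baseChange, map_c₆]
  rw [this, WeierstrassCurve.c₆, hb, hc, hd]
  ring

/-- **`u₀, u₁, u₂` are pairwise distinct as soon as `c₆ ≠ 0`** (`u_i = u_j` gives
`e_i + e_j = 2e_k`, a factor of `c₆`; print: "`b ≠ 0`", `disc f = 3⁶b²Δ³ ≠ 0`).
[cite: DokchitserDokchitserMathZ2012, Lemma (p. 962) (hypothesis b ≠ 0; disc f = 3⁶b²Δ³)] -/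
theorem uT_pairwise_ne_of_c₆_ne_zero (hc₆ : W.c₆ ≠ 0) :
    uT W h2 0 ≠ uT W h2 1 ∧ uT W h2 0 ≠ uT W h2 2 ∧ uT W h2 1 ≠ uT W h2 2 := by
  obtain ⟨-, h4'⟩ := two_four_ne_zero'' (K := K) h2
  obtain ⟨h0, h1, h2e⟩ := uT_eq W h2
  have hne : ∀ i j : Fin 3, i ≠ j → xT W h2 i - xT W h2 j ≠ 0 := fun i j hij ↦
    sub_ne_zero.mpr ((xT_injective W h2).ne hij)
  have hc₆' : algebraMap K (AlgebraicClosure K) W.c₆ ≠ 0 := fun h ↦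
    hc₆ ((algebraMap K (AlgebraicClosure K)).injective (by rw [h, map_zero]))
  rw [algebraMap_c₆_eq W h2] at hc₆'
  have hf := (mul_ne_zero_iff.mp (mul_ne_zero_iff.mp hc₆').2)
  have hf12 := (mul_ne_zero_iff.mp hf.1)
  refine ⟨fun hu ↦ ?_, fun hu ↦ ?_, fun hu ↦ ?_⟩
  · refine hf12.1 ?_
    have : 4 * (xT W h2 0 - xT W h2 1) * (xT W h2 0 + xT W h2 1 - 2 * xT W h2 2) = 0 := by
      rw [h0, h1] at hu; linear_combination hu
    exact (mul_eq_zero.mp this).resolve_left (mul_ne_zero h4' (hne 0 1 (by decide)))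
  · refine hf12.2 ?_
    have : 4 * (xT W h2 0 - xT W h2 2) * (xT W h2 0 + xT W h2 2 - 2 * xT W h2 1) = 0 := by
      rw [h0, h2e] at hu; linear_combination hu
    exact (mul_eq_zero.mp this).resolve_left (mul_ne_zero h4' (hne 0 2 (by decide)))
  · refine hf.2 ?_
    have : 4 * (xT W h2 1 - xT W h2 2) * (xT W h2 1 + xT W h2 2 - 2 * xT W h2 0) = 0 := by
      rw [h1, h2e] at hu; linear_combination hu
    exact (mul_eq_zero.mp this).resolve_left (mul_ne_zero h4' (hne 1 2 (by decide)))

/-- `v_i ≠ ± v_j` for `i ≠ j` when `c₆ ≠ 0`. [cite: DokchitserDokchitserMathZ2012, Lemma (p. 962) (hypothesis b ≠ 0)] -/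
theorem v_add_ne_zero_and_sub_ne_zero_of_c₆_ne_zero (hc₆ : W.c₆ ≠ 0) {i j : Fin 3} (hij : i ≠ j) :
    v W h2 i + v W h2 j ≠ 0 ∧ v W h2 i - v W h2 j ≠ 0 := by
  obtain ⟨h01, h02, h12⟩ := uT_pairwise_ne_of_c₆_ne_zero W h2 hc₆
  have hu : uT W h2 (letter W h2 i) ≠ uT W h2 (letter W h2 j) := by
    have hl : letter W h2 i ≠ letter W h2 j := fun h ↦ hij (letter_injective W h2 h)
    have key : ∀ a b : Fin 3, a ≠ b → uT W h2 a ≠ uT W h2 b := by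
      intro a b hab
      fin_cases a <;> fin_cases b
      · exact absurd rfl hab
      · exact h01
      · exact h02
      · exact fun h ↦ h01 h.symm
      · exact absurd rfl hab
      · exact h12
      · exact fun h ↦ h02 h.symm
      · exact fun h ↦ h12 h.symm
      · exact absurd rfl hab
    exact key _ _ hl
  have hsq : v W h2 i ^ 2 ≠ v W h2 j ^ 2 := fun h ↦
    hu (by rw [← four_mul_v_sq, ← four_mul_v_sq, h])
  constructor
  · intro h
    apply hsq
    have : v W h2 i = -v W h2 j := by linear_combination h
    rw [this, neg_sq]
  · intro h
    apply hsq
    rw [sub_eq_zero.mp h]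

/-- **The four classes are distinct when `c₆ ≠ 0`** (`w_η - w_{η′} = ± 2 v_k (v_i ± v_j)`; print:
"the discriminant of `f` is `3⁶b²Δ³`, so it has no repeated roots and the `θ_C` are distinct").
[cite: DokchitserDokchitserMathZ2012, Lemma (p. 962), proof (the θ_C are distinct)] -/
theorem w_injective_of_c₆_ne_zero (hc₆ : W.c₆ ≠ 0) : Function.Injective (w W h2) := by
  obtain ⟨h2', -⟩ := two_four_ne_zero'' (K := K) h2
  have hv := v_ne_zero W h2
  have hpm := fun (i j : Fin 3) (hij : i ≠ j) ↦
    v_add_ne_zero_and_sub_ne_zero_of_c₆_ne_zero W h2 hc₆ hij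
  have d1 : 2 * v W h2 1 * (v W h2 2 + v W h2 0) ≠ 0 :=
    mul_ne_zero (mul_ne_zero h2' (hv 1)) (hpm 2 0 (by decide)).1
  have d2 : 2 * v W h2 0 * (v W h2 2 + v W h2 1) ≠ 0 :=
    mul_ne_zero (mul_ne_zero h2' (hv 0)) (hpm 2 1 (by decide)).1
  have d3 : 2 * v W h2 2 * (v W h2 1 + v W h2 0) ≠ 0 :=
    mul_ne_zero (mul_ne_zero h2' (hv 2)) (hpm 1 0 (by decide)).1
  have d4 : 2 * v W h2 2 * (v W h2 0 - v W h2 1) ≠ 0 :=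
    mul_ne_zero (mul_ne_zero h2' (hv 2)) (hpm 0 1 (by decide)).2
  have d5 : 2 * v W h2 0 * (v W h2 2 - v W h2 1) ≠ 0 :=
    mul_ne_zero (mul_ne_zero h2' (hv 0)) (hpm 2 1 (by decide)).2
  have d6 : 2 * v W h2 1 * (v W h2 2 - v W h2 0) ≠ 0 :=
    mul_ne_zero (mul_ne_zero h2' (hv 1)) (hpm 2 0 (by decide)).2
  have hw : ∀ η : ZMod 2 × ZMod 2, w W h2 η =
      (sgnUnit (etaf η 0) : AlgebraicClosure K) * (v W h2 1 * v W h2 2) +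
        (sgnUnit (etaf η 1) : AlgebraicClosure K) * (v W h2 2 * v W h2 0) +
        (sgnUnit (etaf η 2) : AlgebraicClosure K) * (v W h2 0 * v W h2 1) := by
    intro η
    rw [w, Fin.sum_univ_three]
    rfl
  intro η η' h
  rw [hw, hw] at h
  revert η η'
  have hs : ∀ η : ZMod 2 × ZMod 2, η = (0, 0) ∨ η = (1, 0) ∨ η = (0, 1) ∨ η = (1, 1) := by decide
  have h11 : (1 : ZMod 2) + 1 = 0 := by decide
  intro η η' h
  rcases hs η with rfl | rfl | rfl | rfl <;> rcases hs η' with rfl | rfl | rfl | rfl <;>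
    simp only [etaf, Matrix.cons_val_zero, Matrix.cons_val_one, Matrix.cons_val, sgnUnit_zero,
      sgnUnit_one, Int.cast_one, Int.cast_neg, zero_add, add_zero, h11] at h ⊢ <;>
    first
    | rfl
    | exact absurd (by linear_combination h) d1
    | exact absurd (by linear_combination -h) d1
    | exact absurd (by linear_combination h) d2
    | exact absurd (by linear_combination -h) d2
    | exact absurd (by linear_combination h) d3
    | exact absurd (by linear_combination -h) d3
    | exact absurd (by linear_combination h) d4
    | exact absurd (by linear_combination -h) d4
    | exact absurd (by linear_combination h) d5
    | exact absurd (by linear_combination -h) d5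
    | exact absurd (by linear_combination h) d6
    | exact absurd (by linear_combination -h) d6

/-! ### §3. (1) ⟹ (3) in print generality -/

/-- An element of `K̄` fixed by `Γ_K` lies in `K` (`K` perfect). [folklore] -/
private theorem exists_eq_algebraMap'' [PerfectField K] {x : AlgebraicClosure K}
    (hx : ∀ σ : Field.absoluteGaloisGroup K, σ • x = x) : ∃ q : K, algebraMap K _ q = x := by
  haveI : IsGalois K (AlgebraicClosure K) := {}
  exact (InfiniteGalois.mem_range_algebraMap_iff_fixed x).mpr fun σ ↦ hx σ

/-- **A `Γ_K`-fixed class makes `j = -4t³(t + 8)`**: `w_{η₀} ∈ K` is a root of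
`64X⁴ + 32ΔX + c₄Δ` (§1 of `TwoAdicImageSurjectivityModFourProofs`), whence `t` (§2 there)
("one of the `θ_C` is rational, equivalently `f` has a rational root" and (2) ⟹ (3)).
[cite: DokchitserDokchitserMathZ2012, Lemma (p. 962), proof ((1) ⟹ (2) ⟹ (3))] -/
theorem exists_j_eq_of_fixed_class [PerfectField K] {η₀ : ZMod 2 × ZMod 2}
    (hfix : ∀ τ : Field.absoluteGaloisGroup K, actQ (tup (M W h2 τ)) η₀ = η₀) :
    ∃ t : K, W.j = -4 * t ^ 3 * (t + 8) := by
  obtain ⟨q, hq⟩ := exists_eq_algebraMap'' (x := w W h2 η₀) fun τ ↦ by rw [smul_w_eq_actQ, hfix]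
  exact exists_j_eq_of_root W h2 (root_of_w_eq W h2 hq.symm)

/-- **Dokchitser–Dokchitser's Lemma, (1) ⟹ (3), in print generality** (`K` perfect, `char K ≠ 2`,
`c₆ ≠ 0`; NO hypothesis on `ρ̄₂`): if a conjugate of `Im ρ̄₄` (in `frame4`) lies in `ℍ`, then
`j = -4t³(t + 8)` for some `t ∈ K`. Proof: `σ ↦ actQ (ρ̄₄ σ)` is the Galois action on the four
(distinct) classes; the `≡ 1 (mod 2)` part of the image lies in `{±1, ±(1 + 2w₀)}` and acts
trivially, so the action factors through the image `Π ≤ S₃` of `σ ↦ π_σ`. If `Π` contains a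
`3`-cycle `π_{σ₃}`, its unique fixed class is fixed by every `τσ₃τ⁻¹ ∈ {σ₃, σ₃²}·ker`, hence by
every `τ`; otherwise `Π = {1, π_{σ₁}}` has order `≤ 2`, `ρ̄₄(σ₁)² ∈ {±1, ±(1 + 2w₀)}`, and a class
fixed by `actQ (ρ̄₄ σ₁)` (§0) is fixed by all of `Γ_K`. A fixed class gives `t`
(`exists_j_eq_of_fixed_class`). [cite: DokchitserDokchitserMathZ2012, Lemma (p. 962), (1) ⟹ (2) ⟹ (3)] -/
theorem exists_j_eq_of_conj_subset_HH_of_c₆_ne_zero [PerfectField K] (hc₆ : W.c₆ ≠ 0)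
    (hk : ∃ k : M4, k.det * k.det = 1 ∧ ∀ σ : Field.absoluteGaloisGroup K,
      tup (k * M W h2 σ * inv' k) ∈ HH) :
    ∃ t : K, W.j = -4 * t ^ 3 * (t + 8) := by
  obtain ⟨k, hkdet, hkH⟩ := hk
  have hinj := w_injective_of_c₆_ne_zero W h2 hc₆
  -- the permutation of the classes induced by `σ`, as a function of the matrix
  set Ψ : Field.absoluteGaloisGroup K → ZMod 2 × ZMod 2 → ZMod 2 × ZMod 2 :=
    fun σ ↦ actQ (tup (M W h2 σ)) with hΨ
  have hΨw : ∀ σ η, σ • w W h2 η = w W h2 (Ψ σ η) := fun σ η ↦ smul_w_eq_actQ W h2 σ η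
  have hmul : ∀ σ τ η, Ψ (σ * τ) η = Ψ σ (Ψ τ η) := by
    intro σ τ η
    apply hinj
    rw [← hΨw, ← hΨw, ← hΨw, mul_smul]
  -- the `≡ 1 (mod 2)` elements of the image act trivially
  have hker : ∀ ν : Field.absoluteGaloisGroup K, pi W h2 ν = 1 → ∀ η, Ψ ν η = η := by
    intro ν hν η
    have h := actE_eq_self_of_tup_mem_four W h2 ν (tup_mem_four_of_conj_subset_HH W h2 hkdet hkH ν hν) η
    rwa [actE_eq_actQ] at h
  suffices h : ∃ η₀, ∀ τ : Field.absoluteGaloisGroup K, Ψ τ η₀ = η₀ from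
    let ⟨η₀, hfix⟩ := h; exists_j_eq_of_fixed_class W h2 hfix
  by_cases h3c : ∃ σ₃ : Field.absoluteGaloisGroup K, ∀ i, pi W h2 σ₃ i ≠ i
  · -- a `3`-cycle and its unique fixed class
    obtain ⟨σ₃, hfree⟩ := h3c
    obtain ⟨η₀, hη₀⟩ := actE_existsUnique_fixed (pi W h2 σ₃) hfree (sgnH W h2 σ₃)
    have hΨ₃ : ∀ η, Ψ σ₃ η = actE (pi W h2 σ₃) (sgnH W h2 σ₃) η := fun η ↦
      (actE_eq_actQ W h2 σ₃ η).symm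
    have hfix₀ : Ψ σ₃ η₀ = η₀ := by rw [hΨ₃]; exact ((hη₀ η₀).1).mpr rfl
    refine ⟨η₀, fun τ ↦ ?_⟩
    have hρ : Ψ (τ * σ₃ * τ⁻¹) (Ψ τ η₀) = Ψ τ η₀ := by
      rw [← hmul, show τ * σ₃ * τ⁻¹ * τ = τ * σ₃ by group, hmul, hfix₀]
    have hpc : pi W h2 (τ * σ₃ * τ⁻¹) = pi W h2 τ * pi W h2 σ₃ * (pi W h2 τ)⁻¹ := by
      rw [pi_mul, pi_mul, pi_inv]
    rcases perm_conj_three_cycle (pi W h2 σ₃) (pi W h2 τ) hfree with hc | hc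
    · have hν : pi W h2 (σ₃⁻¹ * (τ * σ₃ * τ⁻¹)) = 1 := by
        rw [pi_mul, pi_inv, hpc, hc, inv_mul_cancel]
      have hΨρ : Ψ (τ * σ₃ * τ⁻¹) (Ψ τ η₀) = Ψ σ₃ (Ψ τ η₀) := by
        rw [show τ * σ₃ * τ⁻¹ = σ₃ * (σ₃⁻¹ * (τ * σ₃ * τ⁻¹)) by group, hmul, hker _ hν]
      rw [hΨρ, hΨ₃] at hρ
      exact ((hη₀ _).1).mp hρ
    · have hν : pi W h2 ((σ₃ * σ₃)⁻¹ * (τ * σ₃ * τ⁻¹)) = 1 := by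
        rw [pi_mul, pi_inv, pi_mul, hpc, hc, inv_mul_cancel]
      have hΨρ : Ψ (τ * σ₃ * τ⁻¹) (Ψ τ η₀) = Ψ σ₃ (Ψ σ₃ (Ψ τ η₀)) := by
        rw [show τ * σ₃ * τ⁻¹ = σ₃ * σ₃ * ((σ₃ * σ₃)⁻¹ * (τ * σ₃ * τ⁻¹)) by group, hmul, hmul,
          hker _ hν]
      rw [hΨρ, hΨ₃, hΨ₃] at hρ
      exact ((hη₀ _).2).mp hρ
  · -- no `3`-cycle: the image of `σ ↦ π_σ` has order `≤ 2`
    push Not at h3c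
    by_cases htriv : ∀ σ : Field.absoluteGaloisGroup K, pi W h2 σ = 1
    · exact ⟨(0, 0), fun τ ↦ hker τ (htriv τ) _⟩
    · push Not at htriv
      obtain ⟨σ₁, hσ₁⟩ := htriv
      have hpar : Q4.par (tup (M W h2 σ₁)) ≠ (1, 0, 0, 1) := fun h ↦
        hσ₁ ((pi_eq_one_iff W h2 σ₁).mpr h)
      have hsq1 : pi W h2 (σ₁ * σ₁) = 1 := by
        rw [pi_mul]; exact perm_mul_self_of_exists_fixed _ (h3c σ₁)
      have hsq := tup_mem_four_of_conj_subset_HH W h2 hkdet hkH _ hsq1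
      rw [show M W h2 (σ₁ * σ₁) = M W h2 σ₁ * M W h2 σ₁ from map_mul (rhoMat W (frame4 W h2)) σ₁ σ₁,
        tup_mul] at hsq
      obtain ⟨η₀, hη₀⟩ := actQ_exists_fixed _ (det_sq (rhoMat W (frame4 W h2)) σ₁).2 hpar hsq
      refine ⟨η₀, fun τ ↦ ?_⟩
      rcases perm_eq_one_or_eq (pi W h2 σ₁) (pi W h2 τ) hσ₁ (h3c σ₁) (h3c τ)
          (by rw [← pi_inv, ← pi_mul]; exact h3c _) with h1 | h1
      · exact hker τ h1 η₀
      · have hν : pi W h2 (σ₁⁻¹ * τ) = 1 := by rw [pi_mul, pi_inv, h1, inv_mul_cancel]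
        rw [show τ = σ₁ * (σ₁⁻¹ * τ) by group, hmul, hker _ hν]
        exact hη₀

/-! ### §4. (3) ⟹ (1) in print generality -/

/-- **Dokchitser–Dokchitser's Lemma, (3) ⟹ (1), in print generality** (`K` perfect, `char K ≠ 2`,
`c₆ ≠ 0`): if `j = -4t³(t + 8)` for some `t ∈ K`, then a conjugate of `Im ρ̄₄` (in `frame4`) lies
in `ℍ`. Proof: `t` gives a `K`-rational root of `64X⁴ + 32ΔX + c₄Δ`, i.e. a class `w_{η₀} ∈ K`;
the classes being distinct, every `ρ̄₄(σ)` fixes `η₀`, so lies in `Stab(η₀) = k_{η₀}⁻¹ ℍ k_{η₀}`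
(§0) ("the stabilisers of the others are the conjugates of `ℍ`").
[cite: DokchitserDokchitserMathZ2012, Lemma (p. 962), (3) ⟹ (2) ⟹ (1)] -/
theorem conj_subset_HH_of_j_eq_of_c₆_ne_zero [PerfectField K] (hc₆ : W.c₆ ≠ 0) {t : K}
    (ht : W.j = -4 * t ^ 3 * (t + 8)) :
    ∃ k : M4, k.det * k.det = 1 ∧ ∀ σ : Field.absoluteGaloisGroup K,
      tup (k * M W h2 σ * inv' k) ∈ HH := by
  obtain ⟨q, hq⟩ := exists_root_of_j_eq W h2 ht
  obtain ⟨η₀, hη₀⟩ := exists_w_eq_of_root W h2 hq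
  have hinj := w_injective_of_c₆_ne_zero W h2 hc₆
  have hfix : ∀ σ : Field.absoluteGaloisGroup K, actQ (tup (M W h2 σ)) η₀ = η₀ := fun σ ↦ by
    apply hinj
    rw [← smul_w_eq_actQ, hη₀]
    exact (show AlgebraicClosure K ≃ₐ[K] AlgebraicClosure K from σ).commutes q
  refine ⟨ofTup (kstab η₀), by rw [det_eq, tup_ofTup]; exact kstab_det η₀, fun σ ↦ ?_⟩
  rw [tup_mul, tup_mul, tup_inv', tup_ofTup, ← hhPred_iff]
  exact conj_kstab_hhPred_of_actQ_eq η₀ _ (det_sq (rhoMat W (frame4 W h2)) σ).2 (hfix σ)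

/-- **Dokchitser–Dokchitser's Lemma (1) ⟺ (3) over a perfect field with `char K ≠ 2`, under
`c₆ ≠ 0` only** (print's `b ≠ 0`): a conjugate of `Im ρ̄₄` (in `frame4`) lies in `ℍ` iff
`j = -4t³(t + 8)` for some `t ∈ K`. [cite: DokchitserDokchitserMathZ2012, Lemma (p. 962), (1) ⟺ (3)] -/
theorem conj_subset_HH_iff_exists_j_eq_of_c₆_ne_zero [PerfectField K] (hc₆ : W.c₆ ≠ 0) :
    (∃ k : M4, k.det * k.det = 1 ∧ ∀ σ : Field.absoluteGaloisGroup K,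
        tup (k * M W h2 σ * inv' k) ∈ HH) ↔ ∃ t : K, W.j = -4 * t ^ 3 * (t + 8) :=
  ⟨exists_j_eq_of_conj_subset_HH_of_c₆_ne_zero W h2 hc₆,
    fun ⟨_, ht⟩ ↦ conj_subset_HH_of_j_eq_of_c₆_ne_zero W h2 hc₆ ht⟩

/-- Under `c₆ ≠ 0` the image of `ρ̄₄` **is** conjugate into `ℍ` as soon as it fixes a class, and
then it fixes the class of `ℍ` after conjugation: `ℍ` fixes `(1, 0)` (bookkeeping on §0, the
inclusion `ℍ ≤ Stab(θ_ℍ)`). [cite: DokchitserDokchitserMathZ2012, Lemma (p. 962), proof (the stabiliser of θ_ℍ is precisely ℍ)] -/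
theorem actQ_eq_of_mem_HH {h : Q4} (hh : h ∈ HH) : actQ h (1, 0) = (1, 0) :=
  actQ_eq_of_hhPred h ((hhPred_iff h).mpr hh)

end LevelFour

/-! ### §5. Over `ℚ`: any model with `c₆ ≠ 0`, and the printed short Weierstrass form -/

/-- **Dokchitser–Dokchitser's Lemma over `ℚ`, (1) ⟺ (3), in print generality**: for an elliptic
curve `E/ℚ` in any model `W` with `c₆ ≠ 0` (print: `y² = x³ + ax + b` with `b ≠ 0`; `c₆ = -864b`),
`Gal(ℚ(E[4])/ℚ)` (the image of `ρ̄_{E,4}` in the frame `LevelFour.frame4`) is conjugate to a subgroup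
of `ℍ` iff `j(E) = -4t³(t + 8)` for some `t ∈ ℚ`. No hypothesis on `ρ̄_{E,2}` or on `Δ`.
[cite: DokchitserDokchitserMathZ2012, Lemma (p. 962), (1) ⟺ (3)] -/
theorem conj_subset_HH_iff_exists_j_eq_of_c₆_ne_zero (W : WeierstrassCurve ℚ) [W.IsElliptic]
    (hc₆ : W.c₆ ≠ 0) :
    (∃ k : M4, k.det * k.det = 1 ∧ ∀ σ : Field.absoluteGaloisGroup ℚ,
        tup (k * LevelFour.M W two_ne_zero σ * inv' k) ∈ HH) ↔
      ∃ t : ℚ, W.j = -4 * t ^ 3 * (t + 8) := by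
  haveI : PerfectField ℚ := PerfectField.ofCharZero
  exact LevelFour.conj_subset_HH_iff_exists_j_eq_of_c₆_ne_zero W two_ne_zero hc₆

/-- **(2) ⟺ (3) of the Lemma for `y² = x³ + ax + b`, verbatim**: the printed quartic
`f(x) = x⁴ - 4ax³ + 6a²x² + 4(7a³ + 54b²)x + (17a⁴ + 108ab²)` has a rational root iff
`j = -4t³(t + 8)` for some `t ∈ ℚ` (`64·f(r) = 64(a - r)⁴ + 32Δ(a - r) + c₄Δ` with `Δ = -16(4a³ + 27b²)`,
`c₄ = -48a`, and §2 of `TwoAdicImageSurjectivityModFourProofs`). Holds for every elliptic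
`y² = x³ + ax + b`. [cite: DokchitserDokchitserMathZ2012, Lemma (p. 962), (2) ⟺ (3)] -/
theorem exists_root_quartic_iff_exists_j_eq (W : WeierstrassCurve ℚ) [W.IsElliptic]
    (ha₁ : W.a₁ = 0) (ha₂ : W.a₂ = 0) (ha₃ : W.a₃ = 0) :
    (∃ r : ℚ, r ^ 4 - 4 * W.a₄ * r ^ 3 + 6 * W.a₄ ^ 2 * r ^ 2 + 4 * (7 * W.a₄ ^ 3 + 54 * W.a₆ ^ 2) * r
        + (17 * W.a₄ ^ 4 + 108 * W.a₄ * W.a₆ ^ 2) = 0) ↔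
      ∃ t : ℚ, W.j = -4 * t ^ 3 * (t + 8) := by
  have hΔ : W.Δ = -16 * (4 * W.a₄ ^ 3 + 27 * W.a₆ ^ 2) := by
    simp only [WeierstrassCurve.Δ, WeierstrassCurve.b₂, WeierstrassCurve.b₄, WeierstrassCurve.b₆,
      WeierstrassCurve.b₈, ha₁, ha₂, ha₃]
    ring
  have hc₄ : W.c₄ = -48 * W.a₄ := by
    simp only [WeierstrassCurve.c₄, WeierstrassCurve.b₂, WeierstrassCurve.b₄, ha₁, ha₂, ha₃]
    ring
  constructor
  · rintro ⟨r, hr⟩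
    refine exists_j_eq_of_root W two_ne_zero (q := W.a₄ - r) ?_
    rw [hΔ, hc₄]
    linear_combination 64 * hr
  · rintro ⟨t, ht⟩
    obtain ⟨q, hq⟩ := exists_root_of_j_eq W two_ne_zero ht
    refine ⟨W.a₄ - q, ?_⟩
    rw [hΔ, hc₄] at hq
    linear_combination hq / 64

/-- **Dokchitser–Dokchitser 2012, Lemma (p. 962) — PROVED AS PRINTED.** "Let `E/ℚ` be the elliptic
curve `y² = x³ + ax + b` with `b ≠ 0`. The following conditions are equivalent:
(1) `Gal(ℚ(E[4])/ℚ)` is conjugate to a subgroup of `ℍ`. (2) The polynomial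
`f(x) = x⁴ - 4ax³ + 6a²x² + 4(7a³ + 54b²)x + (17a⁴ + 108ab²)` has a rational root.
(3) `j(E) = -4t³(t + 8)` for some `t ∈ ℚ`." Here `W = (0, 0, 0, a, b)`, `Gal(ℚ(E[4])/ℚ)` = the image
of `ρ̄_{E,4}` in the frame `LevelFour.frame4`, `ℍ = GL2Mod4.HH` (index `4`, `HH_facts`); stated as
(1) ⟺ (3) and (2) ⟺ (3). [cite: DokchitserDokchitserMathZ2012, Lemma (p. 962)] -/
theorem lemma_conj_subset_HH_tfae (W : WeierstrassCurve ℚ) [W.IsElliptic]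
    (ha₁ : W.a₁ = 0) (ha₂ : W.a₂ = 0) (ha₃ : W.a₃ = 0) (hb : W.a₆ ≠ 0) :
    ((∃ k : M4, k.det * k.det = 1 ∧ ∀ σ : Field.absoluteGaloisGroup ℚ,
        tup (k * LevelFour.M W two_ne_zero σ * inv' k) ∈ HH) ↔
      ∃ t : ℚ, W.j = -4 * t ^ 3 * (t + 8)) ∧
    ((∃ r : ℚ, r ^ 4 - 4 * W.a₄ * r ^ 3 + 6 * W.a₄ ^ 2 * r ^ 2 + 4 * (7 * W.a₄ ^ 3 + 54 * W.a₆ ^ 2) * r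
        + (17 * W.a₄ ^ 4 + 108 * W.a₄ * W.a₆ ^ 2) = 0) ↔
      ∃ t : ℚ, W.j = -4 * t ^ 3 * (t + 8)) := by
  have hc₆ : W.c₆ = -864 * W.a₆ := by
    simp only [WeierstrassCurve.c₆, WeierstrassCurve.b₂, WeierstrassCurve.b₄, WeierstrassCurve.b₆,
      ha₁, ha₂, ha₃]
    ring
  exact ⟨conj_subset_HH_iff_exists_j_eq_of_c₆_ne_zero W (by rw [hc₆]; exact mul_ne_zero (by norm_num) hb),
    exists_root_quartic_iff_exists_j_eq W ha₁ ha₂ ha₃⟩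

end Literature.NumberTheory.EllipticCurves.DokchitserDokchitser2012

end
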